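import Literature.Computability.QuantumComplexity.MultiCopy
import Literature.Computability.QuantumComplexity.BlockGeom
import Literature.Computability.QuantumComplexity.FanOut
import HarnessLib

/-!
# The AJL core circuit family: fan-out of the digest, then the Hadamard-test copies

Topic `Literature/Computability/QuantumComplexity`; a step in the discharge of
`ajl_jonesApproxProblem_mem_PromiseBQP` (AJL §3.3, Algorithm Approximate-Jones-Plat-Closure, as a
uniform family acting on a classical digest of the instance). On inputs of length `ℓ` the size
parameter is `t = ⌊√(ℓ/16)⌋`; the circuit uses `n = 2t` strands, `r = t` letter slots,
`K = 192 t²` trials of each type (`m = 2K` copies), `k = 2t + 60` averaging bits per gadget, and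
blocks of `bsize n r k` wires (`BlockGeom.lean`) placed after the `ℓ` input wires — the `m` test
qubits first (global wires `ℓ + j`, so that the post-processing finds them without knowing the block
size), then the other wires block by block. Stage 1 copies
the table field and the pattern field of the input into every block with CNOTs (`FanOut.lean`);
stage 2 is the copies circuit of `MultiCopy.lean`. We define the family (`family`), prove it
oracle-free, and compute the content of every block after stage 1 (`blockContent_*`).

## References

* D. Aharonov, V. Jones, Z. Landau, Algorithmica 55 (2009), §3.3 [AharonovJonesLandau2009].
-/

noncomputable section

namespace Literature.Computability.QuantumComplexity

open Cryptography RevSim BlockKit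

namespace AJLCore

/-! ### Sizes -/

/-- The size parameter `t = ⌊√(ℓ/16)⌋`. [folklore] -/
def tOf (ℓ : ℕ) : ℕ := Nat.sqrt (ℓ / 16)

/-- `16 t² ≤ ℓ`. [folklore] -/
theorem sixteen_tOf_sq_le (ℓ : ℕ) : 16 * tOf ℓ ^ 2 ≤ ℓ := by
  have h := Nat.sqrt_le' (ℓ / 16)
  unfold tOf
  have := Nat.div_mul_le_self ℓ 16
  nlinarith

/-- Strands. [folklore] -/
def nOf (ℓ : ℕ) : ℕ := 2 * tOf ℓ
/-- Slots. [folklore] -/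
def rOf (ℓ : ℕ) : ℕ := tOf ℓ
/-- Averaging bits (even, so that the gadget errors are dyadic). [folklore] -/
def kOf (ℓ : ℕ) : ℕ := 2 * tOf ℓ + 60
/-- Trials per type. [folklore] -/
def KOf (ℓ : ℕ) : ℕ := 192 * tOf ℓ ^ 2
/-- Copies (reducible: `Fin (mOf ℓ)` must unify with `Fin (2 * KOf ℓ)`). [folklore] -/
abbrev mOf (ℓ : ℕ) : ℕ := 2 * KOf ℓ
/-- Block size. [folklore] -/
def bOf (ℓ : ℕ) : ℕ := bsize (nOf ℓ) (rOf ℓ) (kOf ℓ)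
/-- Ancillas. [folklore] -/
def anc (ℓ : ℕ) : ℕ := mOf ℓ * bOf ℓ

/-- The geometry of a block. [folklore] -/
def Gb (ℓ : ℕ) : WordGeom (bOf ℓ) (nOf ℓ) (rOf ℓ) := BlockGeom.geom (nOf ℓ) (rOf ℓ) (kOf ℓ)

/-- It is well formed. [folklore] -/
theorem Gb_ok (ℓ : ℕ) : (Gb ℓ).OK := BlockGeom.geom_ok (by unfold kOf; omega)

/-- Blocks are nonempty. [folklore] -/
theorem bOf_pos (ℓ : ℕ) : 1 ≤ bOf ℓ := bsize_pos _ _ _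

/-- `anc = m + m (b - 1)`. [folklore] -/
theorem anc_eq (ℓ : ℕ) : anc ℓ = mOf ℓ + mOf ℓ * (bOf ℓ - 1) := by
  have := bOf_pos ℓ; unfold anc
  calc mOf ℓ * bOf ℓ = mOf ℓ * (1 + (bOf ℓ - 1)) := by congr 1; omega
    _ = mOf ℓ + mOf ℓ * (bOf ℓ - 1) := by ring

/-- The value of the embedding of block `j` at block wire `i`: the test qubits (block wire `0`) of
all blocks come first (`ℓ + j`), then the remaining wires block by block. [folklore] -/
def eblkVal (ℓ : ℕ) (j i : ℕ) : ℕ := if i = 0 then ℓ + j else ℓ + mOf ℓ + j * (bOf ℓ - 1) + (i - 1)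

/-- The embedded wires fit. [folklore] -/
theorem eblkVal_lt (ℓ : ℕ) {j i : ℕ} (hj : j < mOf ℓ) (hi : i < bOf ℓ) : eblkVal ℓ j i < ℓ + anc ℓ := by
  rw [anc_eq]; unfold eblkVal
  split_ifs with h
  · omega
  · have h1 : (j + 1) * (bOf ℓ - 1) ≤ mOf ℓ * (bOf ℓ - 1) := Nat.mul_le_mul_right _ hj
    have h2 : (j + 1) * (bOf ℓ - 1) = j * (bOf ℓ - 1) + (bOf ℓ - 1) := by ring
    have h3 : i - 1 < bOf ℓ - 1 := by omega
    linarith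

/-- The embedded wire values are injective in (block, wire). [folklore] -/
theorem eblkVal_inj (ℓ : ℕ) {j j' i i' : ℕ} (hj : j < mOf ℓ) (hj' : j' < mOf ℓ) (hi : i < bOf ℓ) (hi' : i' < bOf ℓ)
    (h : eblkVal ℓ j i = eblkVal ℓ j' i') : j = j' ∧ i = i' := by
  unfold eblkVal at h
  split_ifs at h with h0 h0'
  · exact ⟨by omega, by omega⟩
  · omega
  · omega
  · -- both in the tail region: `j (b-1) + (i-1) = j' (b-1) + (i'-1)` with `i-1, i'-1 < b-1`
    have hb := bOf_pos ℓ
    have e : j * (bOf ℓ - 1) + (i - 1) = j' * (bOf ℓ - 1) + (i' - 1) := by omega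
    have hi1 : i - 1 < bOf ℓ - 1 := by omega
    have hi1' : i' - 1 < bOf ℓ - 1 := by omega
    have hjj : j = j' := by
      by_contra hne
      rcases lt_or_gt_of_ne hne with hlt | hlt
      · have h1 : (j + 1) * (bOf ℓ - 1) ≤ j' * (bOf ℓ - 1) := Nat.mul_le_mul_right _ hlt
        have h2 : (j + 1) * (bOf ℓ - 1) = j * (bOf ℓ - 1) + (bOf ℓ - 1) := by ring
        linarith
      · have h1 : (j' + 1) * (bOf ℓ - 1) ≤ j * (bOf ℓ - 1) := Nat.mul_le_mul_right _ hlt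
        have h2 : (j' + 1) * (bOf ℓ - 1) = j' * (bOf ℓ - 1) + (bOf ℓ - 1) := by ring
        linarith
    subst hjj
    exact ⟨rfl, by omega⟩

/-- The embedding of block `j`. [folklore] -/
def Eblk (ℓ : ℕ) (j : Fin (mOf ℓ)) : Fin (bOf ℓ) ↪ Fin (ℓ + anc ℓ) :=
  ⟨fun i => ⟨eblkVal ℓ j i, eblkVal_lt ℓ j.2 i.2⟩, fun i i' h => Fin.ext (eblkVal_inj ℓ j.2 j.2 i.2 i'.2 (Fin.ext_iff.1 h)).2⟩

/-- Values of the block wires. [folklore] -/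
theorem Eblk_val (ℓ : ℕ) (j : Fin (mOf ℓ)) (i : Fin (bOf ℓ)) : (Eblk ℓ j i : ℕ) = eblkVal ℓ j i := rfl

/-- Distinct blocks are disjoint. [folklore] -/
theorem blockDisjoint (ℓ : ℕ) : BlockDisjoint (Eblk ℓ) := by
  intro j j' hjj'
  rw [Set.disjoint_left]
  rintro w ⟨i, rfl⟩ ⟨i', h⟩
  exact hjj' (Fin.ext (eblkVal_inj ℓ j.2 j'.2 i.2 i'.2 (Fin.ext_iff.1 h).symm).1)

/-- Block wires are not input wires. [folklore] -/
theorem le_Eblk_val (ℓ : ℕ) (j : Fin (mOf ℓ)) (i : Fin (bOf ℓ)) : ℓ ≤ (Eblk ℓ j i : ℕ) := by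
  rw [Eblk_val]; unfold eblkVal; split_ifs <;> omega

/-- **The test qubit of block `j` is global wire `ℓ + j`.** [folklore] -/
theorem Eblk_q_val (ℓ : ℕ) (j : Fin (mOf ℓ)) : (Eblk ℓ j (Gb ℓ).q : ℕ) = ℓ + j := by
  rw [Eblk_val]
  have hq : (((Gb ℓ).q : Fin (bOf ℓ)) : ℕ) = 0 := BlockGeom.q_val
  unfold eblkVal; rw [if_pos hq]

/-- The type of copy `j`: imaginary-part trials are the last `K`. [cite: AharonovJonesLandau2009, §3.3] -/
def ty (ℓ : ℕ) (j : Fin (mOf ℓ)) : Bool := decide (KOf ℓ ≤ (j : ℕ))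

/-! ### The input fields -/

/-- Position of the table bit of slot `s`, letter `p`. [folklore] -/
def tabPos (ℓ : ℕ) (s : Fin (rOf ℓ)) (p : Fin (nOf ℓ - 1) × Bool) : ℕ := (s : ℕ) * A (nOf ℓ) + BlockGeom.idx p

/-- Position of pattern bit `i`. [folklore] -/
def patPos (ℓ : ℕ) (i : Fin (2 * (nOf ℓ + 1))) : ℕ := rOf ℓ * A (nOf ℓ) + i

/-- The fields fit into the input. [folklore] -/
def Fits (ℓ : ℕ) : Prop := rOf ℓ * A (nOf ℓ) + 2 * (nOf ℓ + 1) ≤ ℓ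

/-- `Fits` is decidable. [folklore] -/
instance (ℓ : ℕ) : Decidable (Fits ℓ) := by unfold Fits; infer_instance

/-- Table positions are below the pattern field. [folklore] -/
theorem tabPos_lt (ℓ : ℕ) (s : Fin (rOf ℓ)) (p : Fin (nOf ℓ - 1) × Bool) : tabPos ℓ s p < rOf ℓ * A (nOf ℓ) := by
  unfold tabPos
  have h1 := BlockGeom.idx_lt p
  have h2 : ((s : ℕ) + 1) * A (nOf ℓ) ≤ rOf ℓ * A (nOf ℓ) := Nat.mul_le_mul_right _ s.2
  nlinarith

/-- The fields fit whenever `t ≥ 1`. [folklore] -/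
theorem fits_of_pos {ℓ : ℕ} (ht : 1 ≤ tOf ℓ) : Fits ℓ := by
  have h := sixteen_tOf_sq_le ℓ
  unfold Fits rOf nOf A
  have : tOf ℓ * (2 * (2 * tOf ℓ - 1)) + 2 * (2 * tOf ℓ + 1) ≤ 16 * tOf ℓ ^ 2 := by
    have e : 2 * (2 * tOf ℓ - 1) = 4 * tOf ℓ - 2 := by omega
    rw [e]
    have : tOf ℓ * (4 * tOf ℓ - 2) ≤ 4 * tOf ℓ ^ 2 := by
      have : tOf ℓ * (4 * tOf ℓ - 2) ≤ tOf ℓ * (4 * tOf ℓ) := Nat.mul_le_mul_left _ (Nat.sub_le _ _)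
      nlinarith
    nlinarith
  omega

/-! ### The fan-out pairs and the circuit -/

variable (ℓ : ℕ)

/-- The (source, target) pairs of the fan-out into block `j`. [folklore] -/
def blockPairs (h : Fits ℓ) (j : Fin (mOf ℓ)) : List (Fin (ℓ + anc ℓ) × Fin (ℓ + anc ℓ)) :=
  ((List.finRange (rOf ℓ)).flatMap fun s => (allLetters (nOf ℓ)).map fun p =>
      (⟨tabPos ℓ s p, by have := tabPos_lt ℓ s p; unfold Fits at h; omega⟩, Eblk ℓ j ((Gb ℓ).tw s p))) ++
    (List.finRange (2 * (nOf ℓ + 1))).map fun i => (⟨patPos ℓ i, by have := i.2; unfold Fits at h; unfold patPos; omega⟩, Eblk ℓ j ((Gb ℓ).E i))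

/-- All fan-out pairs (none if the fields do not fit). [folklore] -/
def pairs : List (Fin (ℓ + anc ℓ) × Fin (ℓ + anc ℓ)) :=
  if h : Fits ℓ then (List.finRange (mOf ℓ)).flatMap (blockPairs ℓ h) else []

/-- Sources are input wires, targets are block wires. [folklore] -/
theorem pairs_src_lt_tgt : ∀ p ∈ pairs ℓ, (p.1 : ℕ) < ℓ ∧ ℓ ≤ (p.2 : ℕ) := by
  intro p hp
  unfold pairs at hp
  split_ifs at hp with h
  · simp only [List.mem_flatMap, List.mem_finRange, true_and, blockPairs, List.mem_append, List.mem_map] at hp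
    obtain ⟨j, hp⟩ := hp
    rcases hp with ⟨s, p', -, rfl⟩ | ⟨i, -, rfl⟩
    · exact ⟨by have := tabPos_lt ℓ s p'; unfold Fits at h; simp only; omega, le_Eblk_val ℓ j _⟩
    · exact ⟨by have := i.2; unfold Fits at h; simp only [patPos]; omega, le_Eblk_val ℓ j _⟩
  · simp at hp

/-- No pair is a loop. [folklore] -/
theorem pairs_ne : ∀ p ∈ pairs ℓ, p.1 ≠ p.2 := fun p hp h => by
  have := pairs_src_lt_tgt ℓ p hp; rw [h] at this; omega

/-- Stage 1: the fan-out. [folklore] -/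
def stage1 : List (QGate cliffordT (ℓ + anc ℓ)) := revCompile (fanoutOps (pairs ℓ) (pairs_ne ℓ))

/-- Stage 2: the copies. [cite: AharonovJonesLandau2009, §3.3] -/
def stage2 : QCircuit cliffordT (ℓ + anc ℓ) := copiesCircuit (Eblk ℓ) fun j => WordGeom.copyCircuit (Gb_ok ℓ) (ty ℓ j)

/-- **The core circuit on inputs of length `ℓ`.** [cite: AharonovJonesLandau2009, §3.3] -/
def circ : QCircuit cliffordT (ℓ + anc ℓ) := ⟨stage1 ℓ ++ (stage2 ℓ).gates⟩

/-- **The AJL core circuit family.** [cite: AharonovJonesLandau2009, §3.3 and Thm. 1.2] -/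
def family : QCircuitFamily cliffordT := ⟨anc, circ⟩

/-- The core circuit is oracle-free. [folklore] -/
theorem circ_isOracleFree : (circ ℓ).IsOracleFree := by
  intro g hg
  change g ∈ stage1 ℓ ++ (stage2 ℓ).gates at hg
  rw [List.mem_append] at hg
  rcases hg with hg | hg
  · exact revCompile_isOracleFree _ g hg
  · exact copiesCircuit_isOracleFree (fun j => WordGeom.copyCircuit_isOracleFree (Gb_ok ℓ) (ty ℓ j)) g hg

/-- The family is oracle-free. [folklore] -/
theorem family_isOracleFree : family.IsOracleFree := fun ℓ => circ_isOracleFree ℓ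

/-- The matrix of the core circuit: copies after fan-out. [folklore] -/
theorem circ_toMatrix : (circ ℓ).toMatrix 0 = (stage2 ℓ).toMatrix 0 * (⟨stage1 ℓ⟩ : QCircuit cliffordT (ℓ + anc ℓ)).toMatrix 0 := by
  rw [show circ ℓ = (⟨stage1 ℓ⟩ : QCircuit cliffordT (ℓ + anc ℓ)).append (stage2 ℓ) from rfl, QCircuit.toMatrix_append]

/-! ### The content of the blocks after the fan-out -/

/-- Values of a padded input. [folklore] -/
theorem padInput_apply {M : ℕ} (xin : QReg ℓ) (w : Fin (ℓ + M)) :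
    padInput xin M w = if h : (w : ℕ) < ℓ then xin ⟨w, h⟩ else false := by
  split_ifs with h
  · have e : padInput xin M (Fin.castAdd M ⟨w, h⟩) = xin ⟨w, h⟩ := by rw [padInput, Fin.append_left]
    convert e using 2; exact Fin.ext rfl
  · have hw : w = Fin.natAdd ℓ ⟨(w : ℕ) - ℓ, by have := w.2; omega⟩ := Fin.ext (by simp; omega)
    rw [hw, padInput, Fin.append_right]

/-- Table wires are injective in (slot, letter). [folklore] -/
theorem tw_injective {s s' : Fin (rOf ℓ)} {p p' : Fin (nOf ℓ - 1) × Bool} (h : (Gb ℓ).tw s p = (Gb ℓ).tw s' p') : s = s' ∧ p = p' := by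
  have hv := congrArg Fin.val h
  rw [Gb, BlockGeom.tw_val, BlockGeom.tw_val, BlockGeom.twNat, BlockGeom.twNat] at hv
  have h1 := BlockGeom.idx_lt p; have h2 := BlockGeom.idx_lt p'
  -- `s·A + idx p = s'·A + idx p'` with `idx < A`
  have hs : (s : ℕ) = s' := by
    by_contra hne
    rcases lt_or_gt_of_ne hne with hlt | hlt
    · have : ((s : ℕ) + 1) * A (nOf ℓ) ≤ (s' : ℕ) * A (nOf ℓ) := Nat.mul_le_mul_right _ hlt
      nlinarith
    · have : ((s' : ℕ) + 1) * A (nOf ℓ) ≤ (s : ℕ) * A (nOf ℓ) := Nat.mul_le_mul_right _ hlt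
      nlinarith
  refine ⟨Fin.ext hs, ?_⟩
  have hidx : BlockGeom.idx p = BlockGeom.idx p' := by rw [hs] at hv; omega
  unfold BlockGeom.idx at hidx
  obtain ⟨i, σ⟩ := p; obtain ⟨i', σ'⟩ := p'
  have : (i : ℕ) = i' ∧ σ = σ' := by cases σ <;> cases σ' <;> simp at hidx ⊢ <;> omega
  exact Prod.ext (Fin.ext this.1) this.2

/-- The targets of the fan-out are pairwise distinct. [folklore] -/
theorem pairs_targets_nodup : ((pairs ℓ).map Prod.snd).Nodup := by
  unfold pairs
  split_ifs with h
  · rw [List.map_flatMap]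
    refine List.nodup_flatMap.2 ⟨fun j _ => ?_, ?_⟩
    · -- inside a block: table targets then path targets
      simp only [blockPairs, List.map_append, List.map_flatMap, List.map_map, Function.comp_def]
      refine List.Nodup.append ?_ ?_ ?_
      · refine List.nodup_flatMap.2 ⟨fun s _ => (allLetters_nodup _).map_on fun p _ p' _ hpp' => (tw_injective ℓ ((Eblk ℓ j).injective hpp')).2, ?_⟩
        refine (List.nodup_finRange _).pairwise_of_forall_ne fun s _ s' _ hss' => ?_
        simp only [Function.onFun, List.disjoint_left, List.mem_map]
        rintro w ⟨p, -, rfl⟩ ⟨p', -, h'⟩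
        exact hss' (tw_injective ℓ ((Eblk ℓ j).injective h')).1.symm
      · exact (List.nodup_finRange _).map_on fun i _ i' _ h' => (Gb ℓ).E.injective ((Eblk ℓ j).injective h')
      · simp only [List.disjoint_left, List.mem_flatMap, List.mem_map, List.mem_finRange, true_and]
        rintro w ⟨s, p, -, rfl⟩ ⟨i, h'⟩
        exact (Gb_ok ℓ).tw_E s p ⟨i, (Eblk ℓ j).injective h'⟩
    · refine (List.nodup_finRange _).pairwise_of_forall_ne fun j _ j' _ hjj' => ?_
      simp only [Function.onFun, List.disjoint_left, blockPairs, List.map_append, List.map_flatMap, List.map_map, Function.comp_def,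
        List.mem_append, List.mem_flatMap, List.mem_map, List.mem_finRange, true_and]
      have hdis := blockDisjoint ℓ j j' hjj'
      rw [Set.disjoint_left] at hdis
      rintro w (⟨s, p, -, rfl⟩ | ⟨i, rfl⟩) (⟨s', p', -, h'⟩ | ⟨i', h'⟩)
      all_goals exact hdis ⟨_, rfl⟩ ⟨_, h'⟩
  · simp

/-- **Input wires are untouched by the fan-out.** [folklore] -/
theorem fanout_input (xin : QReg ℓ) (w : Fin (ℓ + anc ℓ)) (hw : (w : ℕ) < ℓ) :
    revEval (fanoutOps (pairs ℓ) (pairs_ne ℓ)) (padInput xin (anc ℓ)) w = xin ⟨w, hw⟩ := by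
  rw [revEval_fanoutOps_of_not_target _ _ _ w (fun p hp h => by have := pairs_src_lt_tgt ℓ p hp; rw [h] at this; omega), padInput_apply, dif_pos hw]

/-- The fan-out on a target. [folklore] -/
theorem fanout_target (xin : QReg ℓ) {p : Fin (ℓ + anc ℓ) × Fin (ℓ + anc ℓ)} (hp : p ∈ pairs ℓ) :
    revEval (fanoutOps (pairs ℓ) (pairs_ne ℓ)) (padInput xin (anc ℓ)) p.2 = xin ⟨p.1, (pairs_src_lt_tgt ℓ p hp).1⟩ := by
  rw [revEval_fanoutOps_target _ _ (pairs_targets_nodup ℓ) (fun q hq q' hq' h => by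
      have h1 := pairs_src_lt_tgt ℓ q hq; have h2 := pairs_src_lt_tgt ℓ q' hq'; rw [h] at h1; omega) _
    (fun q hq => by rw [padInput_apply, dif_neg (by have := pairs_src_lt_tgt ℓ q hq; omega)]) p hp,
    padInput_apply, dif_pos (pairs_src_lt_tgt ℓ p hp).1]

/-- **Table wires of every block receive the table bits.** [folklore] -/
theorem fanout_tw (h : Fits ℓ) (xin : QReg ℓ) (j : Fin (mOf ℓ)) (s : Fin (rOf ℓ)) (p : Fin (nOf ℓ - 1) × Bool) :
    revEval (fanoutOps (pairs ℓ) (pairs_ne ℓ)) (padInput xin (anc ℓ)) (Eblk ℓ j ((Gb ℓ).tw s p)) =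
      xin ⟨tabPos ℓ s p, by have := tabPos_lt ℓ s p; unfold Fits at h; omega⟩ := by
  have hp : ((⟨tabPos ℓ s p, by have := tabPos_lt ℓ s p; unfold Fits at h; omega⟩, Eblk ℓ j ((Gb ℓ).tw s p)) : Fin (ℓ + anc ℓ) × Fin (ℓ + anc ℓ)) ∈ pairs ℓ := by
    unfold pairs; rw [dif_pos h]
    simp only [List.mem_flatMap, List.mem_finRange, true_and, blockPairs, List.mem_append, List.mem_map]
    exact ⟨j, Or.inl ⟨s, p, mem_allLetters p, rfl⟩⟩
  exact fanout_target ℓ xin hp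

/-- **Path wires of every block receive the pattern bits.** [folklore] -/
theorem fanout_E (h : Fits ℓ) (xin : QReg ℓ) (j : Fin (mOf ℓ)) (i : Fin (2 * (nOf ℓ + 1))) :
    revEval (fanoutOps (pairs ℓ) (pairs_ne ℓ)) (padInput xin (anc ℓ)) (Eblk ℓ j ((Gb ℓ).E i)) =
      xin ⟨patPos ℓ i, by have := i.2; unfold Fits at h; unfold patPos; omega⟩ := by
  have hp : ((⟨patPos ℓ i, by have := i.2; unfold Fits at h; unfold patPos; omega⟩, Eblk ℓ j ((Gb ℓ).E i)) : Fin (ℓ + anc ℓ) × Fin (ℓ + anc ℓ)) ∈ pairs ℓ := by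
    unfold pairs; rw [dif_pos h]
    simp only [List.mem_flatMap, List.mem_finRange, true_and, blockPairs, List.mem_append, List.mem_map]
    exact ⟨j, Or.inr ⟨i, rfl⟩⟩
  exact fanout_target ℓ xin hp

/-- **All other block wires stay off.** [folklore] -/
theorem fanout_other (xin : QReg ℓ) (j : Fin (mOf ℓ)) (i : Fin (bOf ℓ)) (htw : ∀ s p, (Gb ℓ).tw s p ≠ i) (hE : ∀ i', (Gb ℓ).E i' ≠ i) :
    revEval (fanoutOps (pairs ℓ) (pairs_ne ℓ)) (padInput xin (anc ℓ)) (Eblk ℓ j i) = false := by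
  rw [revEval_fanoutOps_of_not_target _ _ _ _ (fun p hp h => ?_), padInput_apply, dif_neg (by have := le_Eblk_val ℓ j i; omega)]
  unfold pairs at hp
  split_ifs at hp with hf
  · simp only [List.mem_flatMap, List.mem_finRange, true_and, blockPairs, List.mem_append, List.mem_map] at hp
    obtain ⟨j', hp⟩ := hp
    have hjj : ∀ i', Eblk ℓ j' i' = Eblk ℓ j i → j' = j ∧ i' = i := fun i' h' => by
      by_cases hj : j' = j
      · subst hj; exact ⟨rfl, (Eblk ℓ j').injective h'⟩
      · exact absurd (Set.disjoint_left.1 (blockDisjoint ℓ j' j hj) ⟨i', rfl⟩ ⟨i, h'.symm ▸ rfl⟩) id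
    rcases hp with ⟨s, p', -, rfl⟩ | ⟨i', -, rfl⟩
    · exact htw s p' (hjj _ h).2
    · exact hE i' (hjj _ h).2
  · simp at hp

end AJLCore

end Literature.Computability.QuantumComplexity

end
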